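import Mathlib.CategoryTheory.Groupoid
import Mathlib.CategoryTheory.Functor.FullyFaithful
import Mathlib.CategoryTheory.Iso
import Mathlib.CategoryTheory.NatIso
import Mathlib.Data.Set.Image
import Literature.IUT.HodgeTheaters.Conventions
import Literature.IUT.HodgeTheaters.PolyIsoFunctoriality
import HarnessLib

/-!
# [IUTchIII] §1–§2: the prime-strip / Hodge-theater FRAME the log-theta-lattice is typed over (interface)

Mochizuki, *Inter-universal Teichmüller Theory III*, kurims manuscript (May 2020), §1–§2
[cite: Mochizuki2012, III Def 1.1 p.23, Prop 1.2 p.30, Prop 1.3 pp.41–42, Def 1.4 p.45, Thm 1.5 pp.48–51]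
(D-0012 claim key, status disputed; this file is an INTERFACE and asserts nothing).

[IUTchIII] §1–§2 never look inside a prime-strip or a Hodge theater: every construction is a
"functorial algorithm" between the categories of such objects and every statement is about
[poly-]isomorphisms induced along those functors. This file therefore bundles, as ONE structure
`StripFrame`, exactly the categories and functors that §1–§2 quote from [IUTchI]/[IUTchII], with the
two rigidity facts they invoke as fields whose docstrings quote print:

* poly-isomorphisms / the full poly-isomorphism / composites [IUTchI, §0 p.33] are the CANONICAL
  `Literature.IUT.HodgeTheaters.PolyIso` of abc-iut-L5-t1's `Conventions.lean` (+ the supplement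
  `PolyIsoFunctoriality.lean`: `map`, `single`, `comp_full_of_nonempty`, …; L6 dedup ruling D2);
* `F`-prime-strips [IUTchI, Def 5.2 (i)], `F^⊢`- [Def 5.2 (ii)], `F^⊩`- [Def 5.2 (iv)],
  `F^{⊢×μ}`-, `F^{⊢▶×μ}`- [IUTchII, Def 4.9 (vii)], `F^{⊩▶×μ}`-prime-strips [IUTchII, Def 4.9 (viii)], `D`- and
  `D^⊢`-prime-strips [IUTchI, Def 4.1 (iii), (iv)] — as CATEGORIES (fields `F`, `Fv`, `Fgl`, `Fxm`, `Fvtxm`,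
  `Fglxm`, `D`, `Dv`);
* the "associated" strips as FUNCTORS: `F ↦ F^⊢` mono-analyticisation and `F ↦ D`, `F^⊢ ↦ D^⊢`
  [IUTchI, Rmk 5.2.1 (i)(ii)], `F^⊢ ↦ F^{⊢×μ}` [IUTchII, Def 4.9 (vi)(vii)], `F^{⊢×μ} ↦ D^⊢`,
  `F^{⊩▶×μ} ↦ F^{⊢▶×μ} ↦ F^{⊢×μ}` [Def 4.9 (viii), (vi)], `D ↦ D^⊢` [IUTchI, Def 4.1 (iv)], with the evident
  compatibilities;
* `Θ^{±ell}NF`-Hodge theaters and `D`-`Θ^{±ell}NF`-Hodge theaters [IUTchI, Def 6.13 (i)(ii)] as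
  categories `HT`, `DHT` with `HT ⥤ DHT`, and the `F`-prime-strips "that appear in the Θ- and
  Θ^±-bridges", labelled `>`, `≻`, `j ∈ J`, `t ∈ T` [IUTchIII, Prop 1.3 (i) p.42; IUTchI, Def 5.5 (ii),
  Def 6.11 (i)], as a family of functors `strip □ : HT ⥤ F` over `dstrip □ : DHT ⥤ D`;
* RIGIDITY [IUTchI, Cor 5.3 (ii) p.144]: "the natural map `Isom(¹F, ²F) → Isom(¹D, ²D)` is
  bijective" — field `toD_isoBij` (bijectivity of `toD.mapIso` on ISOMORPHISMS only: morphisms of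
  `D`-prime-strips are arbitrary collections of morphisms [IUTchI, Def 4.1 (iv)], so `toD` is not asked
  to be full); [IUTchI, Cor 5.3 (iii)]: for `F^⊢`-prime-strips the map to `Isom(¹D^⊢, ²D^⊢)` "is
  surjective" — field `toDv_isoSurj`; the `F`-type strip categories and `HT` are GROUPOIDS
  ([IUTchI] Def 5.2 (iii)/(iv), [IUTchII] Def 4.9 (vii)/(viii): morphisms = isomorphisms) — `IsGroupoid` fields;
* CONNECTEDNESS: any two prime-strips of the same kind are isomorphic (each is by definition
  isomorphic to the model object [IUTchI, Def 5.2 (i): "admits an equivalence of categories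
  `‡C_v ⥲ C_v`"]) — fields `iso_nonempty_*`; used only to know that FULL poly-isomorphisms are nonempty.

Owners of the real definitions (TODO-merge): abc-iut-L5-t4 ([IUTchI] §5–§6: Def 5.2, 6.11, 6.13,
Cor 5.3), abc-iut-L5-t3 ([IUTchI] Def 4.1), abc-iut-L6-t2 ([IUTchII] Def 4.9, Cor 4.10). When those
land, `StripFrame` is to be INSTANTIATED by them (it is a structure, not a class, precisely so that
the eventual concrete model is a term `realFrame : StripFrame`), and nothing typed over it changes.
-/

namespace Literature.IUT.LogThetaLattice

open CategoryTheory
open Literature.IUT.HodgeTheaters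

universe v u


/-! ### The frame -/

/-- **IUTchIII:Def1.1** (kurims p.23) **The prime-strip / Hodge-theater frame of [IUTchIII] §1–§2** (INTERFACE; see the module
docstring for the locator of every field). All categories are "relative to the given initial Θ-data"
[IUTchI, Def 3.1]. One universe `u` for objects and morphisms (instantiate large categories via
`ULift`/`ULiftHom` if needed). [claim: Mochizuki2012, status: disputed] -/
structure StripFrame where
  /-- `F`-prime-strips [IUTchI, Def 5.2 (i)]; "a morphism of `F`- (respectively, `F^⊢`-) prime-strips is
  defined to be a collection of isomorphisms" [Def 5.2 (iii) p.134] — a GROUPOID -/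
  F : Type u
  [catF : Category.{u} F]
  [grpF : IsGroupoid F]
  /-- `F^⊢`-prime-strips (mono-analytic) [IUTchI, Def 5.2 (ii)]; a groupoid [Def 5.2 (iii)] -/
  Fv : Type u
  [catFv : Category.{u} Fv]
  [grpFv : IsGroupoid Fv]
  /-- `F^{⊢×μ}`-prime-strips [IUTchII, Def 4.9 (vii)]; morphisms = collections of isomorphisms (groupoid) -/
  Fxm : Type u
  [catFxm : Category.{u} Fxm]
  [grpFxm : IsGroupoid Fxm]
  /-- `F^{⊢▶×μ}`-prime-strips [IUTchII, Def 4.9 (vii)] (groupoid) -/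
  Fvtxm : Type u
  [catFvtxm : Category.{u} Fvtxm]
  [grpFvtxm : IsGroupoid Fvtxm]
  /-- `F^⊩`-prime-strips (globally realified mono-analytic) [IUTchI, Def 5.2 (iv)]; "a morphism … is
  defined to be an isomorphism between collections of data" (groupoid) -/
  Fgl : Type u
  [catFgl : Category.{u} Fgl]
  [grpFgl : IsGroupoid Fgl]
  /-- `F^{⊩▶×μ}`-prime-strips [IUTchII, Def 4.9 (viii)] (groupoid) -/
  Fglxm : Type u
  [catFglxm : Category.{u} Fglxm]
  [grpFglxm : IsGroupoid Fglxm]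
  /-- `D`-prime-strips [IUTchI, Def 4.1 (iii)]; "a morphism of `D`-prime-strips … is a collection of
  morphisms" [Def 4.1 (iv) p.96] — NOT only isomorphisms (cf. the Θ-bridge arrows of Ex 4.3 (ii)) -/
  D : Type u
  [catD : Category.{u} D]
  /-- `D^⊢`-prime-strips [IUTchI, Def 4.1 (iv)] (arbitrary morphisms, as for `D`) -/
  Dv : Type u
  [catDv : Category.{u} Dv]
  /-- `Θ^{±ell}NF`-Hodge theaters [IUTchI, Def 6.13 (i)] with their isomorphisms (groupoid) -/
  HT : Type u
  [catHT : Category.{u} HT]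
  [grpHT : IsGroupoid HT]
  /-- `D`-`Θ^{±ell}NF`-Hodge theaters [IUTchI, Def 6.13 (ii)] -/
  DHT : Type u
  [catDHT : Category.{u} DHT]
  /-- the `D`-prime-strip associated to an `F`-prime-strip [IUTchI, Rmk 5.2.1 (i)] -/
  toD : F ⥤ D
  /-- the mono-analyticisation `F ↦ F^⊢` [IUTchI, Rmk 5.2.1 (ii)] -/
  toFv : F ⥤ Fv
  /-- the `D^⊢`-prime-strip associated to an `F^⊢`-prime-strip [IUTchI, Rmk 5.2.1 (i)] -/
  FvToDv : Fv ⥤ Dv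
  /-- the `D^⊢`-prime-strip associated to a `D`-prime-strip [IUTchI, Def 4.1 (iv)] -/
  DToDv : D ⥤ Dv
  /-- the `F^{⊢×μ}`-prime-strip associated to an `F^⊢`-prime-strip [IUTchII, Def 4.9 (vi)(vii)] -/
  FvToFxm : Fv ⥤ Fxm
  /-- the `D^⊢`-prime-strip associated to an `F^{⊢×μ}`-prime-strip [IUTchII, Def 4.9 (vii)] -/
  FxmToDv : Fxm ⥤ Dv
  /-- the `F^⊢`-prime-strip underlying an `F^⊩`-prime-strip [IUTchI, Def 5.2 (iv)] -/
  FglToFv : Fgl ⥤ Fv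
  /-- the `F^{⊩▶×μ}`-prime-strip associated to an `F^⊩`-prime-strip [IUTchII, Def 4.9 (viii)] -/
  FglToFglxm : Fgl ⥤ Fglxm
  /-- the `F^{⊢▶×μ}`-prime-strip underlying an `F^{⊩▶×μ}`-prime-strip
  (`*F^{⊩▶×μ} = (*C^⊩, Prime(*C^⊩) ⥲ V̲, *F^{⊢▶×μ}, {*ρ_v})`) [IUTchII, Def 4.9 (viii) p.158] -/
  FglxmToFvtxm : Fglxm ⥤ Fvtxm
  /-- the `F^{⊢×μ}`-prime-strip associated to an `F^{⊢▶×μ}`-prime-strip [IUTchII, Def 4.9 (vi)–(vii)] -/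
  FvtxmToFxm : Fvtxm ⥤ Fxm
  /-- compatibility `F → F^⊢ → D^⊢` = `F → D → D^⊢` [IUTchI, Rmk 5.2.1 (i)(ii)] -/
  toDv_comm : toFv ⋙ FvToDv ≅ toD ⋙ DToDv
  /-- compatibility `F^⊢ → F^{⊢×μ} → D^⊢` = `F^⊢ → D^⊢` [IUTchII, Def 4.9 (vii)] -/
  fxm_comm : FvToFxm ⋙ FxmToDv ≅ FvToDv
  /-- the `D`-`Θ^{±ell}NF`-Hodge theater associated to a `Θ^{±ell}NF`-Hodge theater [IUTchI, Def 6.13 (ii)] -/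
  htToD : HT ⥤ DHT
  /-- labels `□` of "the `F`-prime-strips that appear in the Θ- and Θ^±-bridges": `>`, `≻`, the
  constituents of the capsules `F_J`, `F_T` [IUTchIII, Prop 1.3 (i) p.42] -/
  Label : Type u
  /-- the `F`-prime-strip `†F_□` of a Hodge theater, functorially [IUTchI, Def 5.5 (ii), 6.11 (i)] -/
  strip : Label → (HT ⥤ F)
  /-- the `D`-prime-strip `†D_□` of a `D`-Hodge theater [IUTchI, Def 6.11] -/
  dstrip : Label → (DHT ⥤ D)
  /-- `D(†F_□) = †D_□` compatibly with `HT → DHT` -/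
  strip_comm : ∀ l : Label, strip l ⋙ toD ≅ htToD ⋙ dstrip l
  /-- RIGIDITY [IUTchI, Cor 5.3 (ii) p.144]: "the natural map `Isom(¹F, ²F) → Isom(¹D, ²D)` is bijective"
  — a statement about ISOMORPHISMS (the functor need not be full on the non-invertible morphisms of `D`) -/
  toD_isoBij : ∀ X Y : F, Function.Bijective (fun f : X ≅ Y => toD.mapIso f)
  /-- [IUTchI, Cor 5.3 (iii) p.144]: "the natural map `Isom(¹F^⊢, ²F^⊢) → Isom(¹D^⊢, ²D^⊢)` is surjective" -/
  toDv_isoSurj : ∀ X Y : Fv, Function.Surjective (fun f : X ≅ Y => FvToDv.mapIso f)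
  /-- any two `F`-prime-strips are isomorphic (both isomorphic to the model [IUTchI, Def 5.2 (i)]) -/
  iso_nonempty_F : ∀ X Y : F, Nonempty (X ≅ Y)
  /-- any two `F^{⊢×μ}`-prime-strips are isomorphic [IUTchII, Def 4.9 (vii)] -/
  iso_nonempty_Fxm : ∀ X Y : Fxm, Nonempty (X ≅ Y)
  /-- any two `F^{⊩▶×μ}`-prime-strips are isomorphic [IUTchII, Def 4.9 (viii)] -/
  iso_nonempty_Fglxm : ∀ X Y : Fglxm, Nonempty (X ≅ Y)
  /-- any two `D`-`Θ^{±ell}NF`-Hodge theaters are isomorphic [IUTchI, abstract p.1 "All `Θ^{±ell}NF`-Hodge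
  theaters are isomorphic to one another"; Rmk 6.12.2 (ii) p.174] -/
  iso_nonempty_DHT : ∀ X Y : DHT, Nonempty (X ≅ Y)

attribute [instance] StripFrame.catF StripFrame.catFv StripFrame.catFxm StripFrame.catFvtxm
  StripFrame.catFgl StripFrame.catFglxm StripFrame.catD StripFrame.catDv StripFrame.catHT StripFrame.catDHT
  StripFrame.grpF StripFrame.grpFv StripFrame.grpFxm StripFrame.grpFvtxm StripFrame.grpFgl StripFrame.grpFglxm
  StripFrame.grpHT

namespace StripFrame

variable (S : StripFrame.{u})

/-- **IUTchIII:Def1.1** (kurims p.23) `F ↦ F^{⊢×μ}`, the composite `F → F^⊢ → F^{⊢×μ}` [IUTchII, Def 4.9 (vi)(vii)]. [claim: Mochizuki2012, status: disputed] -/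
def toFxm : S.F ⥤ S.Fxm := S.toFv ⋙ S.FvToFxm

/-- **IUTchII:Def4.9(viii)** (kurims p.158) `F^{⊩▶×μ} ↦ F^{⊢×μ}`: the composite of "underlying `F^{⊢▶×μ}`-prime-strip"
[Def 4.9 (viii)] and "associated `F^{⊢×μ}`-prime-strip" [Def 4.9 (vi)–(vii)]. [claim: Mochizuki2012, status: disputed] -/
abbrev FglxmToFxm : S.Fglxm ⥤ S.Fxm := S.FglxmToFvtxm ⋙ S.FvtxmToFxm

/-- **IUTchIII:Prop1.2** (kurims p.30) `F ↦ D^⊢`, the composite `F → D → D^⊢` [IUTchI, Rmk 5.2.1 (i), Def 4.1 (iv)]. [claim: Mochizuki2012, status: disputed] -/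
def toDv : S.F ⥤ S.Dv := S.toD ⋙ S.DToDv

/-- **IUTchIII:Prop1.3(i)** (kurims p.42) `HT ↦ †D_□`, the `D`-prime-strip labelled `□` of the associated `D`-Hodge theater. [claim: Mochizuki2012, status: disputed] -/
def htDstrip (l : S.Label) : S.HT ⥤ S.D := S.htToD ⋙ S.dstrip l

/-- **IUTchI:§0** (kurims p.33) The full poly-isomorphism between two `F`-prime-strips is nonempty. [claim: Mochizuki2012, status: disputed] -/
theorem full_nonempty_F (X Y : S.F) : (PolyIso.full X Y).Nonempty :=
  ⟨(S.iso_nonempty_F X Y).some, PolyIso.mem_full _⟩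

/-- **IUTchI:§0** (kurims p.33) The full poly-isomorphism between two `D`-`Θ^{±ell}NF`-Hodge theaters is nonempty. [claim: Mochizuki2012, status: disputed] -/
theorem full_nonempty_DHT (X Y : S.DHT) : (PolyIso.full X Y).Nonempty :=
  ⟨(S.iso_nonempty_DHT X Y).some, PolyIso.mem_full _⟩

/-- **IUTchI:Cor5.3(ii)** (kurims p.144) the bijection `Isom(¹F, ²F) ⥲ Isom(¹D, ²D)` as an equivalence.
[claim: Mochizuki2012, status: disputed] -/
noncomputable def isoEquiv (X Y : S.F) : (X ≅ Y) ≃ (S.toD.obj X ≅ S.toD.obj Y) :=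
  Equiv.ofBijective _ (S.toD_isoBij X Y)

/-- **IUTchI:Cor5.3(ii)** (kurims p.144) `isoEquiv` is `toD.mapIso`. [claim: Mochizuki2012, status: disputed] -/
@[simp] theorem isoEquiv_apply {X Y : S.F} (f : X ≅ Y) : S.isoEquiv X Y f = S.toD.mapIso f := rfl

/-- **IUTchI:Cor5.3(ii)** (kurims p.144) [IUTchI] Cor 5.3 (ii) in use: an isomorphism of associated `D`-prime-strips
lifts UNIQUELY to an isomorphism of `F`-prime-strips. [claim: Mochizuki2012, status: disputed] -/
noncomputable def liftIso {X Y : S.F} (e : S.toD.obj X ≅ S.toD.obj Y) : X ≅ Y :=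
  (S.isoEquiv X Y).symm e

/-- **IUTchI:Cor5.3(ii)** (kurims p.144) The lift maps to the given isomorphism. [claim: Mochizuki2012, status: disputed] -/
@[simp] theorem mapIso_liftIso {X Y : S.F} (e : S.toD.obj X ≅ S.toD.obj Y) :
    S.toD.mapIso (S.liftIso e) = e :=
  (S.isoEquiv X Y).apply_symm_apply e

/-- **IUTchI:Cor5.3(ii)** (kurims p.144) Uniqueness of the lift. [claim: Mochizuki2012, status: disputed] -/
theorem liftIso_unique {X Y : S.F} (e : S.toD.obj X ≅ S.toD.obj Y) (f : X ≅ Y)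
    (hf : S.toD.mapIso f = e) : f = S.liftIso e := by
  apply (S.isoEquiv X Y).injective
  rw [isoEquiv_apply, hf]
  exact (S.mapIso_liftIso e).symm

/-- **IUTchI:Cor5.3(ii)** (kurims p.144) consequently `F ↦ D` maps the full poly-isomorphism of `F`-prime-strips
ONTO the full poly-isomorphism of the associated `D`-prime-strips. [claim: Mochizuki2012, status: disputed] -/
theorem map_full_toD (X Y : S.F) :
    (PolyIso.full X Y).map S.toD = PolyIso.full (S.toD.obj X) (S.toD.obj Y) := by
  ext e
  simp only [PolyIso.map, PolyIso.full, Set.image_univ, Set.mem_range, Set.mem_univ, iff_true]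
  exact ⟨S.liftIso e, S.mapIso_liftIso e⟩

/-- **IUTchI:Cor5.3(iii)** (kurims p.144) `F^⊢ ↦ D^⊢` maps the full poly-isomorphism of `F^⊢`-prime-strips ONTO the
full poly-isomorphism of the associated `D^⊢`-prime-strips (surjectivity on isomorphisms).
[claim: Mochizuki2012, status: disputed] -/
theorem map_full_FvToDv (X Y : S.Fv) :
    (PolyIso.full X Y).map S.FvToDv = PolyIso.full (S.FvToDv.obj X) (S.FvToDv.obj Y) := by
  ext e
  simp only [PolyIso.map, PolyIso.full, Set.image_univ, Set.mem_range, Set.mem_univ, iff_true]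
  exact S.toDv_isoSurj X Y e

end StripFrame

end Literature.IUT.LogThetaLattice
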